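import Summits.BirchSwinnertonDyer.BirchSwinnertonDyer.Theses.ToricShedding
import Summits.BirchSwinnertonDyer.BirchSwinnertonDyer.Theses.SelmerRank
import Literature.NumberTheory.EllipticCurves.BSDSelmerSkinnerProofs
import Literature.NumberTheory.EllipticCurves.IwasawaLeadingTermProofs

/-!
# Redirect strategist r1 — crux `ToricShedding.ToricPeriodShedding` (stmt-BirchSwinnertonDyer-16084)

Unit `cstrat-stmt-BirchSwinnertonDyer-16084-r1` (planner, crux-strategist REDIRECT r1, 2026-08-17).
Companion of `STRATEGY-CENSUS.md` in this crux directory.  Every theorem here is sorry-free and is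
quoted by name in the census.  Nothing here edits the route: `closes_points` is a CERTIFIED
RECOMMENDATION for the tenure planner (strategist remit excludes `closes`).

* §1 `UBMult`, `ubMult_of_toricPeriodShedding` — what the deciding theorem `ToricShedding.closes`
  actually extracts from the crux: a Selmer-corank UPPER bound at ONE big-image good ordinary prime,
  on the multiplicative sector (verbatim the first sector of `closes`).
* §2 `NoExcessRankMult`, `noExcessRankMult_of_ubMult`, `ubMult_of_noExcessRankMult_of_sha` — inside
  the route's present cone (which also binds `SelmerRankShaPFinite`, stmt-0132) the crux's
  Ш-content is paid twice: modulo stmt-0132 the crux's slot is `rank ≤ r_an` on the multiplicative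
  sector (the sector form of `Squeeze.SqueezeUB`).
* §3 `ubMult_of_selmerRankUB` — the crux's delivered content is implied by route SelmerRank's
  `SelmerRankUB` (stmt-0130, every big-image prime): it is the WEAKEST typed upper bound in the
  programme (∃ one prime, multiplicative sector).
* §4 `PointsLB`, `pointsLB_of_bsd`, `UBCM`, `closes_points`, `lb_sha_rank_of_points` — the honest
  conjunct split: attacked conjunct = the one-prime upper bound (three sectors: this crux, the
  route's `UBPotentiallyGood`, a CM upper bound), residual = `PointsLB` (the point-existence half of
  BSD, implied by the summit); `SelmerRankLB` (stmt-0131) and `SelmerRankShaPFinite` (stmt-0132)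
  become OUTPUT at the chosen prime.
-/

namespace Summit.BirchSwinnertonDyer.BirchSwinnertonDyer.Cruxes.ToricPeriodShedding.RedirectR1

open Summit.BirchSwinnertonDyer.BirchSwinnertonDyer.Theses.ToricShedding

/-! ## §1 What the crux delivers to `closes` -/

/-- Selmer-corank upper bound at ONE big-image good ordinary prime `p ≥ 5`, for curves with a prime
of multiplicative reduction (global minimal model). -/
def UBMult : Prop :=
  ∀ (W : WeierstrassCurve ℚ) [W.IsElliptic] [W.IsGloballyMinimal],
    (∃ (q : ℕ) (_ : Fact q.Prime), W.HasMultiplicativeReductionAtPrime q) →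
      ∃ (p : ℕ) (_ : Fact p.Prime), 5 ≤ p ∧ W.HasGoodReductionAtPrime p ∧
        ¬ (p : ℤ) ∣ W.frobeniusTrace p ∧ W.HasSurjectiveModNGaloisRep p ∧
        W.selmerCorank p ≤ W.analyticRank

/-- The first sector of `ToricShedding.closes`, verbatim: shedding witness + Kim's bipartite bound +
GZK for the twist give `corank_p Sel_{p^∞}(E/ℚ) ≤ r_an(E)` at the shedding prime. -/
theorem ubMult_of_toricPeriodShedding (hShed : ToricPeriodShedding) (hKim : BipartiteToricBound)
    (hTw : TwistRankLeOne) : UBMult := by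
  intro V _ _ hm
  obtain ⟨p, hp, M, Nplus, Nminus, n, a, b, O, K, hFK, hNK, ψ, I, φ, rep, RI, IsEig, hC, htw, hT,
    hν⟩ := hShed V hm
  obtain ⟨⟨h5, hM, hgood, hord, hsurj, hCR⟩, hrest⟩ := hC
  have hsum : V.selmerCorank p +
      (V.quadraticTwist (NumberField.discr K : ℚ)).selmerCorank p ≤ n.primeFactors.card :=
    hKim V p M Nplus Nminus n a b O K ψ I φ rep RI IsEig ⟨⟨h5, hM, hgood, hord, hsurj, hCR⟩, hrest⟩ hT
  have hd : (NumberField.discr K : ℚ) ≠ 0 := by exact_mod_cast NumberField.discr_ne_zero K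
  haveI := V.isElliptic_quadraticTwist hd
  have htw' : (V.quadraticTwist (NumberField.discr K : ℚ)).analyticRank ≤
      (V.quadraticTwist (NumberField.discr K : ℚ)).selmerCorank p :=
    hTw (V.quadraticTwist (NumberField.discr K : ℚ)) p htw
  exact ⟨p, hp, h5, hgood, hord, hsurj, by omega⟩

/-! ## §2 Modulo the route's Ш-binder the crux's slot is `rank ≤ r_an` -/

/-- No excess rank on the multiplicative sector (the sector form of `Squeeze.SqueezeUB`). -/
def NoExcessRankMult : Prop :=
  ∀ (W : WeierstrassCurve ℚ) [W.IsElliptic] [W.IsGloballyMinimal],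
    (∃ (q : ℕ) (_ : Fact q.Prime), W.HasMultiplicativeReductionAtPrime q) →
      W.mordellWeilRank ≤ W.analyticRank

/-- `UBMult ⇒ NoExcessRankMult`: `rank ≤ corank_p` (Greenberg's identity, proved tree theorem
`selmerCorank_eq_mordellWeilRank_add_holds`); no Ш input. -/
theorem noExcessRankMult_of_ubMult (h : UBMult) : NoExcessRankMult := by
  intro W _ _ hm
  obtain ⟨p, hp, -, -, -, -, hub⟩ := h W hm
  have hid : W.selmerCorank p = W.mordellWeilRank + W.shaCorank p :=
    W.selmerCorank_eq_mordellWeilRank_add_holds p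
  omega

/-- Conversely, GIVEN the route's other binder `SelmerRankShaPFinite` (stmt-0132),
`NoExcessRankMult ⇒ UBMult`: prime supply = multiplicative ⇒ non-CM
(`not_hasCM_of_hasMultiplicativeReductionAtPrime'`, proved) ⇒ a big-image good ordinary `p ≥ 5`
(`SerrePrimeSupply_holds`, proved); then `corank_p = rank + 0 ≤ r_an`.  So inside the present cone
the crux's Ш-content is redundant with stmt-0132. -/
theorem ubMult_of_noExcessRankMult_of_sha (hSha : SelmerRankShaPFinite) (h : NoExcessRankMult) :
    UBMult := by
  intro W _ _ hm
  obtain ⟨q, hq, hmult⟩ := hm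
  have hnCM : ¬ W.HasCM :=
    Literature.NumberTheory.EllipticCurves.not_hasCM_of_hasMultiplicativeReductionAtPrime' W hmult
  obtain ⟨p, hp, h5, hgood, hord, hsurj⟩ := SerrePrimeSupply_holds W hnCM
  refine ⟨p, hp, h5, hgood, hord, hsurj, ?_⟩
  have hid : W.selmerCorank p = W.mordellWeilRank + W.shaCorank p :=
    W.selmerCorank_eq_mordellWeilRank_add_holds p
  have hz : W.shaCorank p = 0 := Literature.BSD.shaCorank_eq_zero_of_finite W p (hSha W p)
  have hr : W.mordellWeilRank ≤ W.analyticRank := h W ⟨q, hq, hmult⟩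
  omega

/-! ## §3 The delivered content sits below route SelmerRank's `SelmerRankUB` (stmt-0130) -/

/-- `SelmerRankUB` (corank ≤ r_an at EVERY big-image good ordinary `p ≥ 5`) ⇒ `UBMult` (at ONE such
prime, multiplicative sector), by the proved prime supply. -/
theorem ubMult_of_selmerRankUB
    (hUB : Summit.BirchSwinnertonDyer.BirchSwinnertonDyer.Theses.SelmerRank.SelmerRankUB) :
    UBMult := by
  intro W _ _ hm
  obtain ⟨q, hq, hmult⟩ := hm
  have hnCM : ¬ W.HasCM :=
    Literature.NumberTheory.EllipticCurves.not_hasCM_of_hasMultiplicativeReductionAtPrime' W hmult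
  obtain ⟨p, hp, h5, hgood, hord, hsurj⟩ := SerrePrimeSupply_holds W hnCM
  exact ⟨p, hp, h5, hgood, hord, hsurj, hUB W p h5 hgood hord hsurj⟩

/-! ## §4 The honest conjunct split: one-prime upper bound (attacked) + `PointsLB` (residual) -/

/-- RESIDUAL: the point-existence half of BSD — no missing points. -/
def PointsLB : Prop :=
  ∀ (W : WeierstrassCurve ℚ) [W.IsElliptic], W.analyticRank ≤ W.mordellWeilRank

/-- The residual is implied by the summit (it is its `≥` half). -/
theorem pointsLB_of_bsd (h : _root_.BirchSwinnertonDyer) : PointsLB := by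
  intro W hW
  exact ((show Literature.BSDRankConjecture from h) W hW).le

/-- Upper bound at one prime on the CM sector (the `≤` half, ∃-form, of the route's `SelmerRankCM`,
stmt-18086). -/
def UBCM : Prop :=
  ∀ (W : WeierstrassCurve ℚ) [W.IsElliptic] [W.IsGloballyMinimal], W.HasCM →
    ∃ (p : ℕ) (_ : Fact p.Prime), W.selmerCorank p ≤ W.analyticRank

/-- One-prime upper bound for every curve (global minimal model), from the three sector items and
the PROVED Serre prime supply. -/
theorem ub_onePrime (hShed : ToricPeriodShedding) (hKim : BipartiteToricBound) (hTw : TwistRankLeOne)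
    (hPG : UBPotentiallyGood) (hCM : UBCM) :
    ∀ (V : WeierstrassCurve ℚ) [V.IsElliptic] [V.IsGloballyMinimal],
      ∃ (p : ℕ) (_ : Fact p.Prime), V.selmerCorank p ≤ V.analyticRank := by
  intro V _ _
  by_cases hm : ∃ (q : ℕ) (_ : Fact q.Prime), V.HasMultiplicativeReductionAtPrime q
  · obtain ⟨p, hp, -, -, -, -, h⟩ := ubMult_of_toricPeriodShedding hShed hKim hTw V hm
    exact ⟨p, hp, h⟩
  · by_cases hc : V.HasCM
    · exact hCM V hc
    · obtain ⟨p, hp, h5, hgood, hord, hsurj⟩ := SerrePrimeSupply_holds V hc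
      exact ⟨p, hp, hPG V hm p h5 hgood hord hsurj⟩

/-- **Recommended deciding theorem (certified, not filed).**  With the residual `PointsLB` in hand
the route needs neither `SelmerRankLB` (stmt-0131) nor `SelmerRankShaPFinite` (stmt-0132):
`rank ≤ corank_p ≤ r_an ≤ rank` at the one prime.  Transport to an arbitrary model exactly as in
`ToricShedding.closes` (T1–T3). -/
theorem closes_points (hShed : ToricPeriodShedding) (hKim : BipartiteToricBound)
    (hTw : TwistRankLeOne) (hPG : UBPotentiallyGood) (hCM : UBCM) (hPts : PointsLB) :
    _root_.BirchSwinnertonDyer := by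
  -- (T1) the Mordell–Weil rank is an isomorphism invariant
  have hMW : ∀ (W : WeierstrassCurve ℚ) (C : WeierstrassCurve.VariableChange ℚ),
      (C • W).mordellWeilRank = W.mordellWeilRank := fun W C =>
    @WeierstrassCurve.VariableChange.finrank_point_variableChange ℚ _ W C (Classical.decEq ℚ)
  -- (T2) the local Euler factor is an isomorphism invariant
  have hloc : ∀ (R : Type) [CommRing R] [IsDomain R] [IsDiscreteValuationRing R]
      (K : Type) [Field K] [Algebra R K] [IsFractionRing R K]
      (W : WeierstrassCurve K) [W.IsElliptic] (C : WeierstrassCurve.VariableChange K),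
      (C • W).localEulerFactor R = W.localEulerFactor R := by
    intro R _ _ _ K _ _ _ W _ C
    obtain ⟨D, hD⟩ : ∃ D : WeierstrassCurve.VariableChange K,
        (C • W).minimal R = D • W.minimal R :=
      ⟨((C • W).exists_isMinimal R).choose * C * ((W.exists_isMinimal R).choose)⁻¹, by
        rw [WeierstrassCurve.minimal, WeierstrassCurve.minimal, mul_smul, mul_smul, inv_smul_smul]⟩
    haveI hE : (W.minimal R).IsElliptic := by rw [WeierstrassCurve.minimal]; infer_instance
    have hΔ : (W.minimal R).Δ ≠ 0 := (W.minimal R).isUnit_Δ.ne_zero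
    have hgood : ((C • W).minimal R).HasGoodReduction R ↔ (W.minimal R).HasGoodReduction R := by
      rw [WeierstrassCurve.hasGoodReduction_iff, WeierstrassCurve.hasGoodReduction_iff,
        WeierstrassCurve.valuation_Δ_eq_of_isMinimal_of_eq_smul R hD]
      exact and_congr_left' ⟨fun _ => inferInstance, fun _ => inferInstance⟩
    have hcard : Nat.card (((C • W).minimal R).reduction R).toAffine.Point =
        Nat.card ((W.minimal R).reduction R).toAffine.Point := by
      obtain ⟨E, hE⟩ := WeierstrassCurve.exists_reduction_eq_smul R hD hΔ
      rw [hE]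
      exact WeierstrassCurve.natCard_point_smul _ _
    have hpoly : (C • W).localPolynomial R = W.localPolynomial R := by
      classical
      unfold WeierstrassCurve.localPolynomial
      simp only [hgood, hcard,
        WeierstrassCurve.hasSplitMultiplicativeReduction_iff_of_isMinimal_of_eq_smul R hD hΔ,
        WeierstrassCurve.hasMultiplicativeReduction_iff_of_isMinimal_of_eq_smul R hD hΔ]
    simp only [WeierstrassCurve.localEulerFactor, WeierstrassCurve.localPowerSeries, hpoly]
  -- (T3) hence the analytic rank is an isomorphism invariant
  have hAn : ∀ (W : WeierstrassCurve ℚ) [W.IsElliptic] (C : WeierstrassCurve.VariableChange ℚ),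
      (C • W).analyticRank = W.analyticRank := by
    intro W _ C
    have hL : (C • W).LFunction = W.LFunction := by
      unfold WeierstrassCurve.LFunction
      congr 1
      funext v
      simp only [WeierstrassCurve.baseChange, ← WeierstrassCurve.map_variableChange]
      exact hloc _ _ _ _
    have hLS : (C • W).LSeries = W.LSeries := by
      funext s
      simp only [WeierstrassCurve.LSeries, hL]
    have hEC : (C • W).entireContinuations = W.entireContinuations := by
      simp only [WeierstrassCurve.entireContinuations, hLS]
    have hEL : (C • W).entireLFunction = W.entireLFunction := by
      unfold WeierstrassCurve.entireLFunction
      rw [hEC, hLS]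
    simp only [WeierstrassCurve.analyticRank, hEL]
  -- the squeeze at one prime on a global minimal model, transported to `W`
  show Literature.BSDRankConjecture
  intro W hW
  obtain ⟨C, hC⟩ := WeierstrassCurve.hasGlobalMinimalModel_rat_holds W
  obtain ⟨p, hp, hub⟩ := ub_onePrime hShed hKim hTw hPG hCM (C • W)
  have hid : (C • W).selmerCorank p = (C • W).mordellWeilRank + (C • W).shaCorank p :=
    (C • W).selmerCorank_eq_mordellWeilRank_add_holds p
  have hpts : (C • W).analyticRank ≤ (C • W).mordellWeilRank := hPts (C • W)
  have h6 := hMW W C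
  have h7 := hAn W C
  omega

/-- At the one prime where `corank_p ≤ r_an` holds, `PointsLB` OUTPUTS the lower bound, the rank
equality and the finiteness of `Ш[p^∞]`: stmt-0131 and stmt-0132 are consequences there, not
inputs. -/
theorem lb_sha_rank_of_points (hPts : PointsLB) (V : WeierstrassCurve ℚ) [V.IsElliptic] (p : ℕ)
    [Fact p.Prime] (hub : V.selmerCorank p ≤ V.analyticRank) :
    V.analyticRank ≤ V.selmerCorank p ∧ V.mordellWeilRank = V.analyticRank ∧
      Finite (AddCommGroup.primaryComponent V.sha p) := by
  have hid : V.selmerCorank p = V.mordellWeilRank + V.shaCorank p :=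
    V.selmerCorank_eq_mordellWeilRank_add_holds p
  have hpts : V.analyticRank ≤ V.mordellWeilRank := hPts V
  refine ⟨by omega, by omega, ?_⟩
  rw [Literature.NumberTheory.EllipticCurves.finite_primaryComponent_sha_iff_shaCorank_eq_zero]
  omega

end Summit.BirchSwinnertonDyer.BirchSwinnertonDyer.Cruxes.ToricPeriodShedding.RedirectR1
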